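import Literature.NumberTheory.LFunctions.KowalskiMichelPeterssonBoundWeilFree
import Literature.NumberTheory.EllipticCurves.AtkinLehnerInvolutionsNewformProofs
import Literature.NumberTheory.EllipticCurves.ModularityVersionAp
import Literature.NumberTheory.EllipticCurves.TwistedLValueSeries
import HarnessLib

/-!
# Prime level, weight 2: the Fricke sign is `−a_f(N)`, and `a_f(N) a_f(n) = a_f(Nn)`
# (inputs of the dual-piece estimate in Bettin 2017, Thm. 1.1 at prime level)

Topic `Literature/NumberTheory/LFunctions` (cell landau-siegel / ls-inputs, input I2 =
`bettin2017_theorem11_primeLevel`, line `hecke_afe_petersson`, stub S5 `stub_dualTail`).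

For a prime level `N` and a newform `f ∈ S_2(Γ₀(N))` (`f ∈ newforms0 N 2`):

* `frickeEigenvalue_eq_neg_cuspCoeff` — `ε_f = −a_f(N)`: Atkin–Lehner 1970, Thm. 3 / Knapp 1993,
  Thm. 9.27 (`c_p = −p^{k/2−1} λ(p)` for `p ∥ N`; here `p = N`, `k = 2`, and `w_N = W_N` is the
  only Atkin–Lehner involution), assembled from the tree's
  `IsNewform0.frickeEigenvalue_eq_prod_atkinLehnerEigenvalueAt_holds` and
  `IsNewform0.atkinLehnerEigenvalueAt_eq_neg_coeff_of_not_dvd`.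
* `cuspCoeff_level_mul` — `a_f(N·n) = a_f(N) a_f(n)` for every `n` (the `U_N`-eigenvalue is
  completely multiplicative: Diamond–Shurman Prop. 5.8.5; tree `IsNewform0.cuspCoeff_prime_mul`).
* `heckeLambda_level_mul` — the same for `λ_f = a_f · n^{−1/2}`: `λ_f(Nn) = λ_f(N) λ_f(n)`.
* `frickeEigenvalue_mul_cuspCoeff` — hence `ε_f · a_f(n) = −a_f(N n)`: the identity that turns the
  dual piece `Σ^h ε_f λ_f(m) D_f(mN)` of the exact central-value formula into harmonic correlations
  `Σ^h λ_f(m) λ_f(Nn)`, to which Petersson's formula applies (Kowalski–Michel 2000, §2.4.2: "since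
  `ε_f = −q^{1/2} λ_f(q)` … by the Hecke relation").

Everything here is proved; no definition, no named fact.

## References
* [AtkinLehner1970] Thm. 3; [Knapp1993] Thm. 9.27; [DiamondShurman2005] Prop. 5.8.5.
* [KowalskiMichel2000] §2.4.2 p. 312 (the same manipulation of `ε_f`).
* [Bettin2017] Lemma 2.1 (the dual integral this replaces at prime level).
-/

noncomputable section

open scoped Real
open Complex CongruenceSubgroup
open Literature.NumberTheory.EllipticCurves.ModularForms

namespace Literature.NumberTheory.LFunctions.Bettin2017

variable {N : ℕ} [NeZero N]

/-- **`ε_f = −a_f(N)` at prime level, weight 2** (Atkin–Lehner 1970, Thm. 3; Knapp 1993,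
Thm. 9.27 with `k = 2`, `p = N ∥ N`): the Fricke eigenvalue of a newform `f ∈ S_2(Γ₀(N))`, `N`
prime, is minus its `N`-th Fourier coefficient. [cite: Knapp1993, Thm. 9.27] -/
theorem frickeEigenvalue_eq_neg_cuspCoeff (hN : N.Prime) {f : CuspForm (Gamma0 N) 2}
    (hf : IsNewform0 f) : frickeEigenvalue f = -cuspCoeff f N := by
  haveI : Fact N.Prime := ⟨hN⟩
  rw [IsNewform0.frickeEigenvalue_eq_prod_atkinLehnerEigenvalueAt_holds hf, hN.primeFactors,
    Finset.prod_singleton]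
  exact hf.atkinLehnerEigenvalueAt_eq_neg_coeff_of_not_dvd N (M := 1) (by simp)
    (by simpa using hN.one_lt.ne')

/-- **`a_f(N n) = a_f(N) a_f(n)`** for a newform of level `Γ₀(N)` (any weight) and every `n`: the
Hecke recursion at a prime dividing the level has no second term (Diamond–Shurman Prop. 5.8.5).
[cite: DiamondShurman2005, Prop. 5.8.5] -/
theorem cuspCoeff_level_mul (hN : N.Prime) {k : ℤ} {f : CuspForm (Gamma0 N) k}
    (hf : IsNewform0 f) (n : ℕ) : cuspCoeff f (N * n) = cuspCoeff f N * cuspCoeff f n := by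
  rw [hf.cuspCoeff_prime_mul hN n, if_pos dvd_rfl, sub_zero]

/-- **`λ_f(N n) = λ_f(N) λ_f(n)`** in the analytic normalisation `λ_f(n) = a_f(n) n^{−(k−1)/2}`
(`GL2Family.heckeLambda`), `N` the (prime) level. [cite: DiamondShurman2005, Prop. 5.8.5] -/
theorem heckeLambda_level_mul (hN : N.Prime) {k : ℤ} {f : CuspForm (Gamma0 N) k}
    (hf : IsNewform0 f) (n : ℕ) :
    GL2Family.heckeLambda f (N * n) = GL2Family.heckeLambda f N * GL2Family.heckeLambda f n := by
  simp only [GL2Family.heckeLambda, cuspCoeff_level_mul hN hf n, Nat.cast_mul]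
  rw [Complex.natCast_mul_natCast_cpow]
  ring

/-- **`ε_f a_f(n) = −a_f(N n)`** (`N` prime, `f ∈ S_2(Γ₀(N))` a newform): the dual coefficients
of the exact central-value formula are again Fourier coefficients of `f`
(Kowalski–Michel 2000, §2.4.2: `ε_f = −q^{1/2} λ_f(q)` and the Hecke relation).
[cite: KowalskiMichel2000, §2.4.2 p. 312] -/
theorem frickeEigenvalue_mul_cuspCoeff (hN : N.Prime) {f : CuspForm (Gamma0 N) 2}
    (hf : IsNewform0 f) (n : ℕ) : frickeEigenvalue f * cuspCoeff f n = -cuspCoeff f (N * n) := by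
  rw [frickeEigenvalue_eq_neg_cuspCoeff hN hf, cuspCoeff_level_mul hN hf n, neg_mul]

/-- The same in the analytic normalisation: `ε_f λ_f(n) = −N^{1/2} λ_f(N n)` (`N` prime, weight 2;
Kowalski–Michel: `ε_f = −q^{1/2} λ_f(q)`). [cite: KowalskiMichel2000, §2.4.2 p. 312] -/
theorem frickeEigenvalue_mul_heckeLambda (hN : N.Prime) {f : CuspForm (Gamma0 N) 2}
    (hf : IsNewform0 f) (n : ℕ) :
    frickeEigenvalue f * GL2Family.heckeLambda f n =
      -((N : ℂ) ^ (1 / 2 : ℂ)) * GL2Family.heckeLambda f (N * n) := by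
  have hN12 : (N : ℂ) ^ (1 / 2 : ℂ) ≠ 0 := by
    rw [Ne, Complex.cpow_eq_zero_iff, not_and_or]
    exact Or.inl (Nat.cast_ne_zero.mpr hN.ne_zero)
  rw [heckeLambda_level_mul hN hf n, ← mul_assoc]
  congr 1
  rw [GL2Family.heckeLambda, ← mul_assoc, frickeEigenvalue_eq_neg_cuspCoeff hN hf]
  have hexp : -((((2 : ℤ) : ℂ) - 1) / 2) = -(1 / 2 : ℂ) := by push_cast; ring
  rw [hexp, Complex.cpow_neg]
  field_simp

end Literature.NumberTheory.LFunctions.Bettin2017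

end
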